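import Mathlib
import Summits.CriticalPhenomena.PercolationContinuityZ3.Theorems.PercNearOneGluingNoHeavyLowerTailSahiCombTriWDipoleCert

/-!
# Block-tilted zeta certificates for `TRI_W(a)`, uniform in the index cube: the type-tilt shape, the five-block design A, and its combinatorial face
# (the THREE-TEST-FAMILY inequality) — typed conjectures and the reductions to `TriWIneq`

Support file of the one-cut programme (crux `NoHeavyLowerTail`, stmt-CriticalPhenomena-4575; cell `prim-masterthm`, seat P5 gen 32; memo
`FROM-prim-masterthm-p5-g32-TILTED-DESIGNS.md`).  In the dipole form of `triW P F G` (`…SahiCombTriWDipoleCert`: demand tokens `D₁(v) = refl P ∩ F v`,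
`D₂(v) = P ∩ refl (F vᶜ)`, `D₃(v) = refl P ∩ refl (F vᶜ)`, supply tokens `A(w) = B(w) = P ∩ F w`, `E(w) = refl P ∩ F wᶜ`, containment `(v,d) ≤ (w,u)` iff
`v ⊆ w ∧ d ⊆ u`) ANY matrix supported on the containment relation with linearly independent demand rows proves `0 ≤ triW P F G` for every monotone
family of up-sets `G` (`triW_nonneg_of_dipoleRankCert`).  The shapes typed so far carry ONE tilt parameter (`CertGenKernel`, `TiltCertIndep`) and are refuted at
`#β + #γ = 6` (`…TriWCertGenFalse`, `…TriWTiltCertFalse`); the per-`a` 0/1 designs of gens 28–30 need new token classes for every index cube.  This file types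
the shape found in gen 32, which is UNIFORM in the index cube and in the fibre cube (memo §2–§4):

  entry of block `(i → j)` at `(v,d) ≤ (w,u)`:   `λ_{ij} · α_{ij} ^ #(w \ v) · β_{ij} ^ #(u \ d)`        (`typeTiltCert θ`, `θ i j = (λ, α, β)`, 27 rationals);

  DESIGN A: only the five blocks `D₁→A`, `D₁→B`, `D₂→A`, `D₃→B`, `D₃→E` are present (`MoveCertIndep`; in the census the index tilts and block weights
  of these blocks may even be taken `= 1`, leaving five fibre tilts);

  its COMBINATORIAL FACE (Hall's condition of the bipartite 'move graph' of design A, memo §4): for ALL monotone families of up-sets `G¹, G², G³`,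
  `Σ_x [#(D₁(x)∩G¹x) + #(D₂(x)∩G²x) + #(D₃(x)∩G³x)] ≤ Σ_x [#(A(x)∩(G¹x ∪ G²x)) + #(B(x)∩(G¹x ∪ G³x)) + #(E(x)∩G³x)]`   (`ThreeTestIneq`);
  `G¹ = G² = G³ = G` is exactly `0 ≤ triW P F G` by the count identity `triW_eq_sup_sub_dem`.

CENSUS (memo §2; engines `code32/rank/drankpc.c`, `code32/kit_certpc/certpc.c`, `code32/kit_certbig/certbig.c`; random parameters modulo `2^61 − 1`, every instance
re-drawn twice before it would count as deficient): design A — hence the 27-parameter shape, of which it is a specialisation — has FULL ROW RANK on every `(P, F)` with `#β + #γ ≤ 5`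
(all cells exhaustive, 1,462,940 configurations at 5), on the cells `(a,n) = (2,4), (3,3), (4,2), (5,1)` at `#β + #γ = 6` EXHAUSTIVELY (`P` modulo the symmetric group of the fibre
cube, all 7,828,354 monotone families `F`: 344,447,532 configurations, kit j251618/j251619), the per-coordinate-tilt variant on ALL cells at `6` incl. `(1,5)` (1,980,573,309
configurations, j249712; also the SYM dipole exhaustively at `5` modulo S₅, 1,622,241,280 configurations), on the `#β + #γ = 6` configuration that refutes `CertGenKernel` /
`TiltCertIndep`, and on 1.5·10⁶ random/structured plus 2.7·10⁶ slack-annealed configurations at `#β + #γ = 6, 7, 8` (j250466, j251800) — including 10⁴ each in the OPEN cells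
(3,5), (4,4), (5,3), where every full-rank instance certifies `0 ≤ triW P F G` for all `G` at once.  Cheaper gluings fail by `#β + #γ ≤ 6` (plain zeta with block weights; one tilt per
block; two essential tilts — this engine reproduces the `TiltCertIndep` counterexample; every 0/±1/2 specialisation of the five tilts).  A census delimits, it proves nothing.

* `FiveUpSet.typeTiltCert θ r c` — the entries; `typeTiltCert_ne_zero` — supported on the containment relation;
* **`FiveUpSet.TypeTiltCertIndep`**, **`FiveUpSet.MoveCertIndep`**, **`FiveUpSet.ThreeTestIneq`** (`@[conjecture]`, obligations of our theory, never facts);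
* `FiveUpSet.typeTiltCertIndep_of_moveCertIndep`, **`FiveUpSet.triWIneq_of_typeTiltCertIndep`**, **`FiveUpSet.triWIneq_of_moveCertIndep`**,
  **`FiveUpSet.triWIneq_of_threeTestIneq`** — the reductions (proved).
HONEST LABEL: one definition, three typed conjectures (census-clean, OPEN) and their proved reductions (std axioms); `TriWIneq` (`a ≥ 3`, `n ≥ 5`) stays OPEN. [this work]
-/

namespace Summit.CriticalPhenomena.PercolationContinuityZ3.Theorems

namespace FiveUpSet

open Finset

variable {β γ : Type} [DecidableEq β] [Fintype β] [DecidableEq γ] [Fintype γ]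

/-- The entries of the block-tilted zeta certificate: at a containment `(v,d) ≤ (w,u)` the block `(r.1 → c.1)` with parameters `θ r.1 c.1 = (λ, α, β)`
contributes `λ · α ^ #(w \ v) · β ^ #(u \ d)`; off the containment relation the entry is `0`. [this work] -/
def typeTiltCert (θ : Fin 3 → Fin 3 → ℚ × ℚ × ℚ) (r c : Token β γ) : ℚ :=
  if r.2.1 ⊆ c.2.1 ∧ r.2.2 ⊆ c.2.2 then
    (θ r.1 c.1).1 * (θ r.1 c.1).2.1 ^ (c.2.1 \ r.2.1).card * (θ r.1 c.1).2.2 ^ (c.2.2 \ r.2.2).card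
  else 0

omit [Fintype β] [Fintype γ] in
/-- The block-tilted certificate is supported on the containment relation of the product cube. [this work] -/
theorem typeTiltCert_ne_zero (θ : Fin 3 → Fin 3 → ℚ × ℚ × ℚ) (r c : Token β γ) (h : typeTiltCert θ r c ≠ 0) :
    r.2.1 ⊆ c.2.1 ∧ r.2.2 ⊆ c.2.2 := by
  by_contra hn
  apply h
  unfold typeTiltCert
  rw [if_neg hn]

/-- **The type-tilt certificate has independent rows** (CONJECTURE — an obligation of our theory, never a fact; memo §2).  For every finite index cube
`Finset β`, fibre cube `Finset γ`, up-set `P` and monotone family of up-sets `F` some table of 27 rationals makes the demand rows of `typeTiltCert θ`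
(indexed by `dipoleDem P F`, as vectors on `dipoleSup P F`) linearly independent. OPEN. [this work] -/
@[conjecture] def TypeTiltCertIndep : Prop :=
  ∀ (β γ : Type) [DecidableEq β] [Fintype β] [DecidableEq γ] [Fintype γ]
    (P : Finset (Finset γ)) (F : Finset β → Finset (Finset γ)),
    IsUpperSet (P : Set (Finset γ)) → (∀ x, IsUpperSet (F x : Set (Finset γ))) → Monotone F →
      ∃ θ : Fin 3 → Fin 3 → ℚ × ℚ × ℚ,
        LinearIndependent ℚ (fun r : ↥(dipoleDem P F) => fun c : ↥(dipoleSup P F) => typeTiltCert θ r.1 c.1)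

/-- **Design A has independent rows** (CONJECTURE — an obligation of our theory, never a fact; memo §3): as `TypeTiltCertIndep`, with the four blocks
`D₁→E`, `D₂→B`, `D₂→E`, `D₃→A` absent (block weight `0`); i.e. the five-block design `D₁→A,B`, `D₂→A`, `D₃→B,E`. OPEN. [this work] -/
@[conjecture] def MoveCertIndep : Prop :=
  ∀ (β γ : Type) [DecidableEq β] [Fintype β] [DecidableEq γ] [Fintype γ]
    (P : Finset (Finset γ)) (F : Finset β → Finset (Finset γ)),
    IsUpperSet (P : Set (Finset γ)) → (∀ x, IsUpperSet (F x : Set (Finset γ))) → Monotone F →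
      ∃ θ : Fin 3 → Fin 3 → ℚ × ℚ × ℚ, (θ 0 2).1 = 0 ∧ (θ 1 1).1 = 0 ∧ (θ 1 2).1 = 0 ∧ (θ 2 0).1 = 0 ∧
        LinearIndependent ℚ (fun r : ↥(dipoleDem P F) => fun c : ↥(dipoleSup P F) => typeTiltCert θ r.1 c.1)

/-- **The three-test-family inequality** (CONJECTURE — an obligation of our theory, never a fact; memo §4): Hall's condition for the move graph of design A.
For every up-set `P`, monotone family of up-sets `F` and THREE monotone families of up-sets `G¹, G², G³` of the fibre cube (indexed by the index cube):
`Σ_x [#(refl P ∩ F x ∩ G¹ x) + #(P ∩ refl (F xᶜ) ∩ G² x) + #(refl P ∩ refl (F xᶜ) ∩ G³ x)]`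
  `≤ Σ_x [#(P ∩ F x ∩ (G¹ x ∪ G² x)) + #(P ∩ F x ∩ (G¹ x ∪ G³ x)) + #(refl P ∩ F xᶜ ∩ G³ x)]`.
With `G¹ = G² = G³` this is `0 ≤ triW P F G` (`triWIneq_of_threeTestIneq`).  Census: exhaustive over all `(P, F, G¹, G², G³)` for `#β + #γ = 3` (1.12·10⁶ checks),
by max-flow over all `(P, F)` for `#β + #γ ≤ 4`, and implied by every full-rank instance of design A. OPEN. [this work] -/
@[conjecture] def ThreeTestIneq : Prop :=
  ∀ (β γ : Type) [DecidableEq β] [Fintype β] [DecidableEq γ] [Fintype γ]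
    (P : Finset (Finset γ)) (F G₁ G₂ G₃ : Finset β → Finset (Finset γ)),
    IsUpperSet (P : Set (Finset γ)) → (∀ x, IsUpperSet (F x : Set (Finset γ))) → Monotone F →
    (∀ x, IsUpperSet (G₁ x : Set (Finset γ))) → Monotone G₁ → (∀ x, IsUpperSet (G₂ x : Set (Finset γ))) → Monotone G₂ →
    (∀ x, IsUpperSet (G₃ x : Set (Finset γ))) → Monotone G₃ →
      (∑ x : Finset β, (((refl P ∩ F x ∩ G₁ x).card : ℤ) + (P ∩ refl (F xᶜ) ∩ G₂ x).card + (refl P ∩ refl (F xᶜ) ∩ G₃ x).card))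
        ≤ ∑ x : Finset β, (((P ∩ F x ∩ (G₁ x ∪ G₂ x)).card : ℤ) + (P ∩ F x ∩ (G₁ x ∪ G₃ x)).card + (refl P ∩ F xᶜ ∩ G₃ x).card)

/-- Design A is a specialisation of the type-tilt shape, so its independence implies `TypeTiltCertIndep`. [this work] -/
theorem typeTiltCertIndep_of_moveCertIndep (h : MoveCertIndep) : TypeTiltCertIndep := by
  intro β γ _ _ _ _ P F hP hF hFm
  obtain ⟨θ, -, -, -, -, hθ⟩ := h β γ P F hP hF hFm
  exact ⟨θ, hθ⟩

/-- **`TypeTiltCertIndep → TriWIneq`**: the block-tilted certificate is a dipole rank certificate (`triWIneq_of_dipoleRankCert`). [this work] -/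
theorem triWIneq_of_typeTiltCertIndep (h : TypeTiltCertIndep) : TriWIneq := by
  refine triWIneq_of_dipoleRankCert ?_
  intro β γ _ _ _ _ P F hP hF hFm
  obtain ⟨θ, hθ⟩ := h β γ P F hP hF hFm
  exact ⟨typeTiltCert θ, fun r c hrc => typeTiltCert_ne_zero θ r c hrc, hθ⟩

/-- **`MoveCertIndep → TriWIneq`**. [this work] -/
theorem triWIneq_of_moveCertIndep (h : MoveCertIndep) : TriWIneq :=
  triWIneq_of_typeTiltCertIndep (typeTiltCertIndep_of_moveCertIndep h)

/-- **`ThreeTestIneq → TriWIneq`**: take the three test families equal to `G` and use the count identity `triW_eq_sup_sub_dem`. [this work] -/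
theorem triWIneq_of_threeTestIneq (h : ThreeTestIneq) : TriWIneq := by
  intro β γ _ _ _ _ P F G hP hF hG hFm hGm
  have h3 := h β γ P F G G G hP hF hFm hG hGm hG hGm hG hGm
  rw [triW_eq_sup_sub_dem]
  have e1 : ∑ x : Finset β, (((P ∩ F x ∩ (G x ∪ G x)).card : ℤ) + (P ∩ F x ∩ (G x ∪ G x)).card + (refl P ∩ F xᶜ ∩ G x).card)
      = ∑ x : Finset β, (2 * ((P ∩ F x ∩ G x).card : ℤ) + (refl P ∩ F xᶜ ∩ G x).card) := by
    refine sum_congr rfl fun x _ => ?_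
    rw [union_self]
    ring
  rw [e1] at h3
  linarith

/-! ### Design A ⟹ the three-test-family inequality (restriction to three test families) -/

omit [DecidableEq β] in
/-- Tokens of a level-indexed family of sets, restricted class by class to three test families, counted level by level. [this work] -/
theorem card_filter_token₃ (S T : Fin 3 → Finset β → Finset (Finset γ)) :
    ((univ : Finset (Token β γ)).filter (fun t => t.2.2 ∈ S t.1 t.2.1 ∧ t.2.2 ∈ T t.1 t.2.1)).card
      = ∑ x : Finset β, ((S 0 x ∩ T 0 x).card + (S 1 x ∩ T 1 x).card + (S 2 x ∩ T 2 x).card) := by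
  rw [card_filter, Fintype.sum_prod_type, Fin.sum_univ_three]
  have h : ∀ i : Fin 3, ∑ p : Finset β × Finset γ, (if p.2 ∈ S i p.1 ∧ p.2 ∈ T i p.1 then 1 else 0)
      = ∑ x : Finset β, (S i x ∩ T i x).card := by
    intro i
    rw [Fintype.sum_prod_type]
    refine sum_congr rfl fun x _ => ?_
    rw [← card_filter]
    congr 1
    ext u
    simp [mem_inter]
  rw [h 0, h 1, h 2, ← sum_add_distrib, ← sum_add_distrib]

/-- The test family attached to a DEMAND class: `D₁ ↦ G₁`, `D₂ ↦ G₂`, `D₃ ↦ G₃`. [this work] -/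
def demTest (G₁ G₂ G₃ : Finset β → Finset (Finset γ)) (i : Fin 3) (x : Finset β) : Finset (Finset γ) :=
  if i = 0 then G₁ x else if i = 1 then G₂ x else G₃ x

/-- The test family attached to a SUPPLY class under design A: `A ↦ G₁ ∪ G₂`, `B ↦ G₁ ∪ G₃`, `E ↦ G₃`. [this work] -/
def supTest (G₁ G₂ G₃ : Finset β → Finset (Finset γ)) (j : Fin 3) (x : Finset β) : Finset (Finset γ) :=
  if j = 0 then G₁ x ∪ G₂ x else if j = 1 then G₁ x ∪ G₃ x else G₃ x

omit [Fintype β] [Fintype γ] in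
/-- Under design A a demand token inside its class's test family only meets supply tokens inside the supply class's test family. [this work] -/
theorem typeTiltCert_eq_zero_of_not_mem (θ : Fin 3 → Fin 3 → ℚ × ℚ × ℚ)
    (h02 : (θ 0 2).1 = 0) (h11 : (θ 1 1).1 = 0) (h12 : (θ 1 2).1 = 0) (h20 : (θ 2 0).1 = 0)
    (G₁ G₂ G₃ : Finset β → Finset (Finset γ))
    (hG₁ : ∀ x, IsUpperSet (G₁ x : Set (Finset γ))) (hG₁m : Monotone G₁)
    (hG₂ : ∀ x, IsUpperSet (G₂ x : Set (Finset γ))) (hG₂m : Monotone G₂)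
    (hG₃ : ∀ x, IsUpperSet (G₃ x : Set (Finset γ))) (hG₃m : Monotone G₃)
    (r c : Token β γ) (hr : r.2.2 ∈ demTest G₁ G₂ G₃ r.1 r.2.1) (hc : c.2.2 ∉ supTest G₁ G₂ G₃ c.1 c.2.1) :
    typeTiltCert θ r c = 0 := by
  by_contra hne
  obtain ⟨hvw, hdu⟩ := typeTiltCert_ne_zero θ r c hne
  have hlam : (θ r.1 c.1).1 ≠ 0 := by
    intro hz
    apply hne
    unfold typeTiltCert
    rw [if_pos ⟨hvw, hdu⟩, hz, zero_mul, zero_mul]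
  -- move the point up inside each test family
  have up1 : r.2.2 ∈ G₁ r.2.1 → c.2.2 ∈ G₁ c.2.1 := fun h => hG₁ c.2.1 hdu (hG₁m hvw h)
  have up2 : r.2.2 ∈ G₂ r.2.1 → c.2.2 ∈ G₂ c.2.1 := fun h => hG₂ c.2.1 hdu (hG₂m hvw h)
  have up3 : r.2.2 ∈ G₃ r.2.1 → c.2.2 ∈ G₃ c.2.1 := fun h => hG₃ c.2.1 hdu (hG₃m hvw h)
  obtain ⟨i, hi⟩ : ∃ i, r.1 = i := ⟨_, rfl⟩
  obtain ⟨j, hj⟩ : ∃ j, c.1 = j := ⟨_, rfl⟩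
  rw [hi, hj] at hlam
  unfold demTest at hr
  unfold supTest at hc
  rw [hi] at hr
  rw [hj] at hc
  fin_cases i <;> fin_cases j <;> simp_all

/-- **`MoveCertIndep → ThreeTestIneq`**: the rows of design A that lie in the three test families are supported on the supply columns inside the
attached families (`typeTiltCert_eq_zero_of_not_mem`), so they stay independent after restriction and are at most as many as those columns. [this work] -/
theorem threeTestIneq_of_moveCertIndep (h : MoveCertIndep) : ThreeTestIneq := by
  intro β γ _ _ _ _ P F G₁ G₂ G₃ hP hF hFm hG₁ hG₁m hG₂ hG₂m hG₃ hG₃m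
  obtain ⟨θ, h02, h11, h12, h20, hli⟩ := h β γ P F hP hF hFm
  -- restricted rows and columns
  set Dt := (dipoleDem P F).filter (fun t => t.2.2 ∈ demTest G₁ G₂ G₃ t.1 t.2.1) with hDt
  set St := (dipoleSup P F).filter (fun t => t.2.2 ∈ supTest G₁ G₂ G₃ t.1 t.2.1) with hSt
  let ι : ↥Dt → ↥(dipoleDem P F) := fun r => ⟨r.1, (mem_filter.1 r.2).1⟩
  have hι : Function.Injective ι := by
    intro r s hrs
    apply Subtype.ext
    have h' := congrArg Subtype.val hrs
    exact h'
  have hli' := hli.comp ι hι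
  have hliR : LinearIndependent ℚ (fun r : ↥Dt => fun c : ↥St => typeTiltCert θ r.1 c.1) := by
    rw [Fintype.linearIndependent_iff] at hli' ⊢
    intro g hg
    apply hli' g
    funext c
    rw [Finset.sum_apply]
    simp only [Pi.smul_apply, smul_eq_mul, Pi.zero_apply, Function.comp_apply]
    by_cases hc : c.1.2.2 ∈ supTest G₁ G₂ G₃ c.1.1 c.1.2.1
    · have h0 := congrFun hg ⟨c.1, mem_filter.2 ⟨c.2, hc⟩⟩
      rw [Finset.sum_apply] at h0
      simpa only [Pi.smul_apply, smul_eq_mul, Pi.zero_apply] using h0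
    · refine sum_eq_zero fun r _ => ?_
      have hr : (r.1).2.2 ∈ demTest G₁ G₂ G₃ (r.1).1 (r.1).2.1 := (mem_filter.1 r.2).2
      rw [typeTiltCert_eq_zero_of_not_mem θ h02 h11 h12 h20 G₁ G₂ G₃ hG₁ hG₁m hG₂ hG₂m hG₃ hG₃m r.1 c.1 hr hc, mul_zero]
  have hcard := hliR.fintype_card_le_finrank
  rw [Module.finrank_fintype_fun_eq_card, Fintype.card_coe, Fintype.card_coe] at hcard
  -- count both sides
  have hdem : Dt.card = ∑ x : Finset β, ((refl P ∩ F x ∩ G₁ x).card + (P ∩ refl (F xᶜ) ∩ G₂ x).card + (refl P ∩ refl (F xᶜ) ∩ G₃ x).card) := by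
    rw [hDt]
    unfold dipoleDem
    rw [filter_filter, card_filter_token₃ (demSet P F) (demTest G₁ G₂ G₃)]
    refine sum_congr rfl fun x _ => ?_
    simp [demSet, demTest]
  have hsup : St.card = ∑ x : Finset β, ((P ∩ F x ∩ (G₁ x ∪ G₂ x)).card + (P ∩ F x ∩ (G₁ x ∪ G₃ x)).card + (refl P ∩ F xᶜ ∩ G₃ x).card) := by
    rw [hSt]
    unfold dipoleSup
    rw [filter_filter, card_filter_token₃ (supSet P F) (supTest G₁ G₂ G₃)]
    refine sum_congr rfl fun x _ => ?_
    simp [supSet, supTest]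
  rw [hdem, hsup] at hcard
  exact_mod_cast hcard

end FiveUpSet

end Summit.CriticalPhenomena.PercolationContinuityZ3.Theorems
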